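import Summits.BirchSwinnertonDyer.Rank1Residual.X11b.BDPRouteRelaxation
import Literature.NumberTheory.EllipticCurves.CasselsTateLevelInputsOfCanonical
import Literature.NumberTheory.GaloisCohomology.PoitouTatePrimaryReduction
import Literature.NumberTheory.GaloisRepresentations.LocalKummerTorsion
import HarnessLib

/-!
# Cassels–Tate × Poitou–Tate bridge, part 1: Milne's descended local pairing at level `m²` through THE invariant maps is
# `m` times the level-`m` Weil cup product (route `SemiOrdinaryEisensteinDescent`, print debt `CasselsTateLevelInputsFact`
# stmt-BirchSwinnertonDyer-20191 = conjunct 1 of `KolyvaginPrimitivesAtThree` stmt-25896; width seat `bsd-wall-soed-p2-w3` g4,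
# `--supports stmt-BirchSwinnertonDyer-25898`, helper)

HONEST FRAMING. THEOREMS ONLY (no definition, no named fact, no `sorry`, no instance); nothing here proves a case of BSD or of
Poitou–Tate. The sequel `…CasselsTateLemma615OfPoitouTateAt.lean` uses this bridge to DISCHARGE the Lemma-6.15 input `h615`
of `casselsTate_levelInputs_of_canonical_inputs` (one of the four displayed residuals of the CT fact for THE family
`LocalInvariants.canonical K (m·m)`) from Poitou–Tate AT THE ONE MODULE `E[m]` at level `m` — unconditionally at `m = p`.

THE BRIDGE (Milne *ADT* I §6, proof of Prop. 6.9; Serre, *Corps locaux* XIII §3 Cor. 3). The Cassels–Tate recipe of the tree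
pairs `H¹(K_v, E[m])` with itself through the DESCENDED pairing `E[m] × E[m] → μ_{m²}` (`descendPairing`: `(S, T) ↦ e_{m²}(ι S, T̃)`,
`[m]T̃ = T`) read by `inv^{(m²)}_v` (`descLocalPairing`, `sumPairing`), whereas the kernel's Poitou–Tate statements AT `E[m]` live at
level `m` (`invWeilPairing`, `localTatePairingZMod … m`). Reading the descended pairing as a `K̄`-valued Weil-type pairing
`eD(S, T) = desc(S, T)` at level `m`:
* §1 `descFun_pow/_add₁/_add₂/_smul/_self/_nondeg` — `eD` takes values in `μ_m`, is biadditive, `Γ_K`-equivariant, alternating and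
  non-degenerate (from the tree's `descendHom_*`); `muInclusion_weilPairingHom_descFun` — `ι_{μ_m ⊆ μ_{m²}} ∘ w_{eD} = desc`.
* §2 `natCast_val_mul_sum`, `eq_zero_of_natCast_val_mul_eq_zero` — `a ↦ m·a : ℤ/m → ℤ/m²` is additive on sums and injective.
* §3 `descLocalPairing_canonical_inr` — at a FINITE place, `inv^{(m²)}_v(a ∪_desc b) = m · inv^{(m)}_v(a ∪_{eD} b)` in `ℤ/m²`:
  `∪_desc = H²(μ_m ⊆ μ_{m²})|_{Γ_{K_v}} ∘ ∪_{eD}` (covariant naturality `ContPairing.cupProduct_map`) and the LEVEL COMPATIBILITY of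
  THE residue maps of `K_v` on LOCAL classes (`Prop121vii.invariantMap_muInclHom_compat` transported along `muLocalIso`);
  `descLocalPairing_canonical_eq` — the same at every place for odd `m` (`H¹(K_w, E[m]) = 0` at the infinite places).

References: [MilneADT2006] I §6 proof of Prop. 6.9, Lemma 6.15; [SerreLocalFields1979] XIII §3 Cor. 3;
[NeukirchSchmidtWingberg2008] I §4 (1.4.2). BSD is not proved by any of this.
-/

noncomputable section

open scoped Classical

-- the Theorems namespace of this sub repeats the summit name by design (D-0017 nested layout)
set_option linter.dupNamespace false
set_option autoImplicit false

open CategoryTheory Field NumberField IsDedekindDomain Function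
open Literature.NumberTheory.EllipticCurves Literature.NumberTheory.GaloisCohomology
  Literature.NumberTheory.GaloisRepresentations
open Literature.NumberTheory.GaloisRepresentations.DiscreteGaloisModule (mu MuCarrier SelmerStructure unramifiedSubgroup
  localTatePairingZMod tateDual)
open _root_.WeierstrassCurve
open Summit.BirchSwinnertonDyer.Rank1Residual.X11b.Relaxation (invWeilPairing invWeilPairing_apply)

namespace Summit.BirchSwinnertonDyer.BirchSwinnertonDyer.Theorems.CasselsTateLemma615OfPT

/-! ## §1 The descended pairing read at level `m`: a Weil-type `μ_m`-valued pairing `eD` on `E[m]` -/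

section DescFun

variable {K : Type} [Field K] [NumberField K] (W : WeierstrassCurve K) (m : ℕ) [NeZero m]
variable (e : geomTorsion W ((m * m : ℕ) : ℤ) → geomTorsion W ((m * m : ℕ) : ℤ) → AlgebraicClosure K)
  (hμ : ∀ S T, e S T ^ (m * m) = 1)
  (hadd₁ : ∀ S₁ S₂ T, e (S₁ + S₂) T = e S₁ T * e S₂ T)
  (hadd₂ : ∀ S T₁ T₂, e S (T₁ + T₂) = e S T₁ * e S T₂)

/-- `eD(S, T)^m = 1`: the descended pairing `desc(S, T) = e_{m²}(ι S, T̃)` takes values in `μ_m` on `E[m]`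
(`desc(mS, T) = desc(0, T)`). [cite: MilneADT2006, Ch. I §6, proof of Prop. 6.9] -/
theorem descFun_pow (S T : geomTorsion W (m : ℤ)) :
    ((muVal K (m * m) (descendHom W m m e hμ hadd₁ hadd₂ S T) : (AlgebraicClosure K)ˣ) : AlgebraicClosure K) ^ m = 1 := by
  rw [← Units.val_pow_eq_pow_val, ← muVal_nsmul, ← AddMonoidHom.flip_apply, ← map_nsmul]
  have hS : m • S = 0 := by simpa only [Int.natAbs_natCast] using natAbs_nsmul_geomTorsion W S
  rw [hS, map_zero, muVal_zero, Units.val_one]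

/-- `eD` is additive in the first variable. [folklore] -/
theorem descFun_add₁ (S₁ S₂ T : geomTorsion W (m : ℤ)) :
    ((muVal K (m * m) (descendHom W m m e hμ hadd₁ hadd₂ (S₁ + S₂) T) : (AlgebraicClosure K)ˣ) : AlgebraicClosure K) =
      ((muVal K (m * m) (descendHom W m m e hμ hadd₁ hadd₂ S₁ T) : (AlgebraicClosure K)ˣ) : AlgebraicClosure K) *
        ((muVal K (m * m) (descendHom W m m e hμ hadd₁ hadd₂ S₂ T) : (AlgebraicClosure K)ˣ) : AlgebraicClosure K) := by
  rw [map_add, AddMonoidHom.add_apply, muVal_add, Units.val_mul]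

/-- `eD` is additive in the second variable. [folklore] -/
theorem descFun_add₂ (S T₁ T₂ : geomTorsion W (m : ℤ)) :
    ((muVal K (m * m) (descendHom W m m e hμ hadd₁ hadd₂ S (T₁ + T₂)) : (AlgebraicClosure K)ˣ) : AlgebraicClosure K) =
      ((muVal K (m * m) (descendHom W m m e hμ hadd₁ hadd₂ S T₁) : (AlgebraicClosure K)ˣ) : AlgebraicClosure K) *
        ((muVal K (m * m) (descendHom W m m e hμ hadd₁ hadd₂ S T₂) : (AlgebraicClosure K)ˣ) : AlgebraicClosure K) := by
  rw [map_add, muVal_add, Units.val_mul]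

/-- `eD` is `Γ_K`-equivariant (`descendHom_smul`). [folklore] -/
theorem descFun_smul
    (hgal : ∀ (σ : absoluteGaloisGroup K) (S T : geomTorsion W ((m * m : ℕ) : ℤ)), σ • e S T = e (σ • S) (σ • T))
    (σ : absoluteGaloisGroup K) (S T : geomTorsion W (m : ℤ)) :
    σ • ((muVal K (m * m) (descendHom W m m e hμ hadd₁ hadd₂ S T) : (AlgebraicClosure K)ˣ) : AlgebraicClosure K) =
      ((muVal K (m * m) (descendHom W m m e hμ hadd₁ hadd₂ (σ • S) (σ • T)) : (AlgebraicClosure K)ˣ) :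
        AlgebraicClosure K) := by
  rw [descendHom_smul W m m e hμ hadd₁ hadd₂ hgal, muVal_apply, Units.coe_smul]

/-- `eD` is alternating if `e` is (`descendHom_self`). [folklore] -/
theorem descFun_self (halt : ∀ T, e T T = 1) (T : geomTorsion W (m : ℤ)) :
    ((muVal K (m * m) (descendHom W m m e hμ hadd₁ hadd₂ T T) : (AlgebraicClosure K)ˣ) : AlgebraicClosure K) = 1 := by
  rw [descendHom_self W m m e hμ hadd₁ hadd₂ halt, muVal_zero, Units.val_one]

/-- `eD` is non-degenerate in the second variable if `e` is (`eq_zero_of_forall_descendHom_eq_zero`). [folklore] -/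
theorem descFun_nondeg (hnd : ∀ T, (∀ S, e S T = 1) → T = 0) (T : geomTorsion W (m : ℤ))
    (hT : ∀ S, ((muVal K (m * m) (descendHom W m m e hμ hadd₁ hadd₂ S T) : (AlgebraicClosure K)ˣ) :
      AlgebraicClosure K) = 1) : T = 0 := by
  refine eq_zero_of_forall_descendHom_eq_zero W m m e hμ hadd₁ hadd₂ hnd T fun S => ?_
  apply muVal_injective K (m * m)
  rw [muVal_zero]
  exact Units.ext (hT S)

/-- **`ι ∘ eD = desc`**: the level-`m` Weil pairing hom of `eD` followed by `μ_m ⊆ μ_{m²}` is the descended pairing hom.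
[cite: MilneADT2006, Ch. I §6, proof of Prop. 6.9] -/
theorem muInclusion_weilPairingHom_descFun (S T : geomTorsion W (m : ℤ)) :
    muInclusion K (dvd_mul_right m m)
        (weilPairingHom W m
          (fun S T => ((muVal K (m * m) (descendHom W m m e hμ hadd₁ hadd₂ S T) : (AlgebraicClosure K)ˣ) :
            AlgebraicClosure K))
          (descFun_pow W m e hμ hadd₁ hadd₂) (descFun_add₁ W m e hμ hadd₁ hadd₂) (descFun_add₂ W m e hμ hadd₁ hadd₂) S T) =
      descendHom W m m e hμ hadd₁ hadd₂ S T := by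
  apply muVal_injective K (m * m)
  rw [muVal_muInclusion]
  exact Units.ext (coe_weilPairingHom W m _ _ _ _ S T)

/-! ## §2 Two arithmetic helpers on `a ↦ m·a : ℤ/m → ℤ/m²` -/

omit [NeZero m] in
/-- `(x % m)·m ≡ x·m (mod m²)`. [folklore] -/
theorem natCast_mod_mul_eq (x : ℕ) : (((x % m) * m : ℕ) : ZMod (m * m)) = ((x * m : ℕ) : ZMod (m * m)) := by
  rw [ZMod.natCast_eq_natCast_iff', Nat.mul_mod_mul_right, Nat.mul_mod_mul_right, Nat.mod_mod]

/-- `a ↦ m · a : ℤ/m → ℤ/m²` is additive on finite sums. [folklore] -/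
theorem natCast_val_mul_sum {ι : Type} (s : Finset ι) (f : ι → ZMod m) :
    ((((∑ i ∈ s, f i).val * m : ℕ)) : ZMod (m * m)) = ∑ i ∈ s, (((f i).val * m : ℕ) : ZMod (m * m)) := by
  induction s using Finset.induction_on with
  | empty => simp
  | insert i s hi ih =>
    rw [Finset.sum_insert hi, Finset.sum_insert hi, ← ih, ZMod.val_add, natCast_mod_mul_eq, add_mul, Nat.cast_add]

/-- `a ↦ m · a : ℤ/m → ℤ/m²` is injective. [folklore] -/
theorem eq_zero_of_natCast_val_mul_eq_zero (a : ZMod m) (h : (((a.val * m : ℕ)) : ZMod (m * m)) = 0) : a = 0 := by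
  rw [ZMod.natCast_eq_zero_iff] at h
  have hm : 0 < m := NeZero.pos m
  have h' : m ∣ a.val := Nat.dvd_of_mul_dvd_mul_right hm h
  have hlt : a.val < m := ZMod.val_lt a
  have h0 : a.val = 0 := Nat.eq_zero_of_dvd_of_lt h' hlt
  exact (ZMod.val_eq_zero a).mp h0

end DescFun

/-! ## §3 The bridge: `inv^{(m²)}_v(a ∪_desc b) = m · inv^{(m)}_v(a ∪_{eD} b)` for THE invariant maps -/

section Bridge

variable {K : Type} [Field K] [NumberField K] (W : WeierstrassCurve K) (m : ℕ) [NeZero m]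
variable (e : geomTorsion W ((m * m : ℕ) : ℤ) → geomTorsion W ((m * m : ℕ) : ℤ) → AlgebraicClosure K)
  (hμ : ∀ S T, e S T ^ (m * m) = 1)
  (hadd₁ : ∀ S₁ S₂ T, e (S₁ + S₂) T = e S₁ T * e S₂ T)
  (hadd₂ : ∀ S T₁ T₂, e S (T₁ + T₂) = e S T₁ * e S T₂)
  (hgal : ∀ (σ : absoluteGaloisGroup K) (S T : geomTorsion W ((m * m : ℕ) : ℤ)), σ • e S T = e (σ • S) (σ • T))
/-- **Milne's local pairing at a FINITE place through THE invariant maps is `m` times the level-`m` Weil pairing of `eD`**: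
`inv^{(m²)}_v(a ∪_desc b) = m · inv^{(m)}_v(a ∪_{eD} b)` in `ℤ/m²` for `a, b ∈ H¹(K_v, E[m])`. Proof: `∪_desc = H²(μ_m ⊆ μ_{m²}) ∘ ∪_{eD}`
(covariant naturality of the cup product, `ContPairing.cupProduct_map`, along `ι ∘ eD = desc`) and the level compatibility of
THE residue maps of `K_v` (`Prop121vii.invariantMap_muInclHom_compat`, Serre XIII §3 Cor. 3) transported along `muLocalIso`.
[cite: SerreLocalFields1979, XIII §3 Cor. 3] [cite: MilneADT2006, Ch. I §6, proof of Prop. 6.9] -/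
theorem descLocalPairing_canonical_inr (v : HeightOneSpectrum (𝓞 K))
    (a b : galoisCohomology ((W.torsionGaloisModule (m : ℤ)).toLocal (Sum.inr v)) 1) :
    descLocalPairing W m e hμ hadd₁ hadd₂ hgal (LocalInvariants.canonical K (m * m)) (Sum.inr v) a b =
      (((invWeilPairing W m
          (fun S T => ((muVal K (m * m) (descendHom W m m e hμ hadd₁ hadd₂ S T) : (AlgebraicClosure K)ˣ) :
            AlgebraicClosure K))
          (descFun_pow W m e hμ hadd₁ hadd₂) (descFun_add₁ W m e hμ hadd₁ hadd₂) (descFun_add₂ W m e hμ hadd₁ hadd₂)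
          (descFun_smul W m e hμ hadd₁ hadd₂ hgal) (LocalInvariants.canonical K m) (Sum.inr v) a b).val * m : ℕ) :
        ZMod (m * m)) := by
  haveI : CharZero (v.adicCompletion K) := charZero_adicCompletion v
  -- cup products need `LocallyCompactSpace Γ`
  haveI : CompactSpace (absoluteGaloisGroup K) := absoluteGaloisGroup_compactSpace K
  haveI : CompactSpace (absoluteGaloisGroup (Place.Completion (Sum.inr v : Place K))) := absoluteGaloisGroup_compactSpace _
  -- the inclusion `μ_m ⊆ μ_{m²}` restricted to `Γ_{K_v}`
  let γ : ((mu K m).toLocal (Sum.inr v : Place K)).toTopRep ⟶ ((mu K (m * m)).toLocal (Sum.inr v : Place K)).toTopRep :=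
    TopRep.ofHom ((muInclHom K (dvd_mul_right m m)).hom.restrict
      (absGaloisRestrict K (Place.Completion (Sum.inr v : Place K)) :
        absoluteGaloisGroup (Place.Completion (Sum.inr v : Place K)) →* absoluteGaloisGroup K))
  have hγ : ∀ x, γ.hom x = muInclusion K (dvd_mul_right m m) x := fun _ => rfl
  -- (B) the descended cup product is `H²(γ)` of the level-`m` Weil cup product of `eD`
  have hB : ((descendPairing W m m e hμ hadd₁ hadd₂ hgal).restrict
        (absGaloisRestrict K (Place.Completion (Sum.inr v : Place K)))).cupProduct a b =
      cohomologyMap γ 2 ((weilContPairingLocal W m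
          (fun S T => ((muVal K (m * m) (descendHom W m m e hμ hadd₁ hadd₂ S T) : (AlgebraicClosure K)ˣ) :
            AlgebraicClosure K))
          (descFun_pow W m e hμ hadd₁ hadd₂) (descFun_add₁ W m e hμ hadd₁ hadd₂) (descFun_add₂ W m e hμ hadd₁ hadd₂)
          (descFun_smul W m e hμ hadd₁ hadd₂ hgal) (Sum.inr v)).cupProduct a b) := by
    have hmap := ContPairing.cupProduct_map
      (weilContPairingLocal W m
        (fun S T => ((muVal K (m * m) (descendHom W m m e hμ hadd₁ hadd₂ S T) : (AlgebraicClosure K)ˣ) :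
          AlgebraicClosure K))
        (descFun_pow W m e hμ hadd₁ hadd₂) (descFun_add₁ W m e hμ hadd₁ hadd₂) (descFun_add₂ W m e hμ hadd₁ hadd₂)
        (descFun_smul W m e hμ hadd₁ hadd₂ hgal) (Sum.inr v))
      ((descendPairing W m m e hμ hadd₁ hadd₂ hgal).restrict
        (absGaloisRestrict K (Place.Completion (Sum.inr v : Place K)))) (𝟙 _) (𝟙 _) γ (fun x y =>
          muInclusion_weilPairingHom_descFun W m e hμ hadd₁ hadd₂ x y) a b
    have ha : cohomologyMap (𝟙 ((W.torsionGaloisModule (m : ℤ)).toLocal (Sum.inr v : Place K)).toTopRep) 1 a = a :=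
      map_apply_of_id _ (fun _ => rfl) _ (fun _ => rfl) 1 a
    have hb : cohomologyMap (𝟙 ((W.torsionGaloisModule (m : ℤ)).toLocal (Sum.inr v : Place K)).toTopRep) 1 b = b :=
      map_apply_of_id _ (fun _ => rfl) _ (fun _ => rfl) 1 b
    exact (hmap.trans (congrArg₂ (fun x y => ((descendPairing W m m e hμ hadd₁ hadd₂ hgal).restrict
        (absGaloisRestrict K (Place.Completion (Sum.inr v : Place K)))).cupProduct x y) ha hb)).symm
  -- (C) level change for THE invariant maps on local classes
  have hC : ∀ c : galoisCohomology ((mu K m).toLocal (Sum.inr v : Place K)) 2,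
      localInvariantMap K (m * m) v (cohomologyMap γ 2 c) = (((localInvariantMap K m v c).val * m : ℕ) : ZMod (m * m)) := by
    intro c
    rw [localInvariantMap_apply, localInvariantMap_apply]
    have key : (cohomologyMap (muLocalIso v (m * m)).hom 2) (cohomologyMap γ 2 c) =
        cohomologyMap (muInclHom (v.adicCompletion K) (dvd_mul_right m m)) 2 ((cohomologyMap (muLocalIso v m).hom 2) c) := by
      obtain ⟨c₀, rfl⟩ := twoCocycleClass_surjective _ c
      rw [cohomologyMap_twoCocycleClass]
      erw [cohomologyMap_twoCocycleClass, cohomologyMap_twoCocycleClass, cohomologyMap_twoCocycleClass]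
      refine congrArg (twoCocycleClass _) (Subtype.ext (ContinuousMap.ext fun q => ?_))
      obtain ⟨σ, τ⟩ := q
      apply muVal_injective (v.adicCompletion K) (m * m)
      rfl
    have h := Literature.AnabelianGeometry.AbsoluteAnabelian.Prop121vii.invariantMap_muInclHom_compat
      (v.adicCompletion K) (dvd_mul_right m m) _ _
      (Literature.AnabelianGeometry.AbsoluteAnabelian.Prop121vii.isInvariantMap_invLevel _ m)
      (Literature.AnabelianGeometry.AbsoluteAnabelian.Prop121vii.isInvariantMap_invLevel _ (m * m))
      ((cohomologyMap (muLocalIso v m).hom 2) c)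
    rw [Nat.mul_div_cancel_left m (NeZero.pos m)] at h
    rw [← h, ← key]
  rw [descLocalPairing_apply, invWeilPairing_apply,
    LocalInvariants.canonical_inr, LocalInvariants.canonical_inr, hB, hC]


/-- At an INFINITE place and ODD `m` both local pairings vanish identically (`H¹(K_w, E[m]) = 0`, the tree's
`galoisCohomology_one_torsion_eq_zero_infinitePlace_of_odd`), so the finite-place identity holds at every place.
[cite: MilneADT2006, Ch. I §6, proof of Prop. 6.9] -/
theorem descLocalPairing_canonical_eq (hodd : Odd m) (v : Place K)
    (a b : galoisCohomology ((W.torsionGaloisModule (m : ℤ)).toLocal v) 1) :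
    descLocalPairing W m e hμ hadd₁ hadd₂ hgal (LocalInvariants.canonical K (m * m)) v a b =
      (((invWeilPairing W m
          (fun S T => ((muVal K (m * m) (descendHom W m m e hμ hadd₁ hadd₂ S T) : (AlgebraicClosure K)ˣ) :
            AlgebraicClosure K))
          (descFun_pow W m e hμ hadd₁ hadd₂) (descFun_add₁ W m e hμ hadd₁ hadd₂) (descFun_add₂ W m e hμ hadd₁ hadd₂)
          (descFun_smul W m e hμ hadd₁ hadd₂ hgal) (LocalInvariants.canonical K m) v a b).val * m : ℕ) :
        ZMod (m * m)) := by
  rcases v with w | v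
  · have ha : a = 0 :=
      galoisCohomology_one_torsion_eq_zero_infinitePlace_of_odd W w ((Int.odd_coe_nat _).mpr hodd) a
    have h1 : descLocalPairing W m e hμ hadd₁ hadd₂ hgal (LocalInvariants.canonical K (m * m)) (Sum.inl w) a b = 0 := by
      rw [ha]
      exact DFunLike.congr_fun
        (map_zero (descLocalPairing W m e hμ hadd₁ hadd₂ hgal (LocalInvariants.canonical K (m * m)) (Sum.inl w))) b
    have h2 : invWeilPairing W m
        (fun S T => ((muVal K (m * m) (descendHom W m m e hμ hadd₁ hadd₂ S T) : (AlgebraicClosure K)ˣ) :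
          AlgebraicClosure K))
        (descFun_pow W m e hμ hadd₁ hadd₂) (descFun_add₁ W m e hμ hadd₁ hadd₂) (descFun_add₂ W m e hμ hadd₁ hadd₂)
        (descFun_smul W m e hμ hadd₁ hadd₂ hgal) (LocalInvariants.canonical K m) (Sum.inl w) a b = 0 := by
      rw [ha]
      exact DFunLike.congr_fun (map_zero (invWeilPairing W m
        (fun S T => ((muVal K (m * m) (descendHom W m m e hμ hadd₁ hadd₂ S T) : (AlgebraicClosure K)ˣ) :
          AlgebraicClosure K))
        (descFun_pow W m e hμ hadd₁ hadd₂) (descFun_add₁ W m e hμ hadd₁ hadd₂) (descFun_add₂ W m e hμ hadd₁ hadd₂)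
        (descFun_smul W m e hμ hadd₁ hadd₂ hgal) (LocalInvariants.canonical K m) (Sum.inl w))) b
    rw [h1, h2, ZMod.val_zero, zero_mul, Nat.cast_zero]
  · exact descLocalPairing_canonical_inr W m e hμ hadd₁ hadd₂ hgal v a b

end Bridge

end Summit.BirchSwinnertonDyer.BirchSwinnertonDyer.Theorems.CasselsTateLemma615OfPT

end
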